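import Mathlib.Analysis.SpecialFunctions.Complex.LogBounds
import Mathlib.Analysis.SpecialFunctions.Pow.Deriv
import Literature.Analysis.Complex.ArgumentPrincipleRectangle
import HarnessLib

/-!
# The mean of `log ‖F‖` along a vertical segment for `F` close to `1` on a half-strip

Trunk T-ANALYSIS support (`Literature/Analysis/Complex`). In Levinson's method (Levinson 1974, §2,
between (2.4) and (2.5)) and in Selberg's, Littlewood's lemma is applied on a rectangle whose right
edge `Re s = b` lies in the half-plane of absolute convergence, and one needs the right-edge term
`∫_T^{T+U} log|F(b + it)| dt` to be bounded independently of `U`: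
"`log ψ(s)` is analytic for `σ ≥ 3`. Integrating on the contour `σ + iT, 3 ≤ σ < ∞; 3 + it,
T ≤ t ≤ T + U; σ + i(T+U), 3 ≤ σ < ∞` gives `|∫_T^{T+U} log ψ(3 + it) dt| ≤ 8 ∫_3^∞ dσ/2^σ = O(1)`
and so `∫_T^{T+U} log|ψ(3 + it)| dt = O(1)`" (Levinson, p. 387; likewise for `log ζ(3+it)`, and
`∫ log|G(3+it)| dt = ∫ log|ζ(3+it)| dt + O(U/L)`).

We prove this in general, for `F` analytic with `‖F − 1‖ ≤ g(σ) ≤ ½` on a closed half-strip: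

* `Literature.Analysis.Complex.norm_integral_log_vertical_le` — on a finite rectangle
  `[x₀, R] × [T₁, T₂]`: `‖∫_{T₁}^{T₂} log F(x₀+it) dt‖ ≤ (3/2)(2∫_{x₀}^R g + (T₂ − T₁) g(R))`
  (Cauchy–Goursat for the principal `log F`, which is analytic since `F` stays in the disc
  `|w − 1| ≤ ½`, and `‖log w‖ ≤ (3/2)‖w − 1‖` there);
* `Literature.Analysis.Complex.abs_integral_log_norm_vertical_le` — the same bound for
  `|∫_{T₁}^{T₂} log‖F(x₀+it)‖ dt|` (real part);
* `Literature.Analysis.Complex.abs_integral_log_norm_vertical_le_of_geometric_decay` — if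
  `‖F(σ+it) − 1‖ ≤ C·2^{x₀−σ}` on the whole half-strip `σ ≥ x₀`, `C ≤ ½` (the case of a Dirichlet
  series `1 + Σ_{n≥2} a_n n^{-s}` with `Σ_{n≥2} |a_n| n^{-x₀} ≤ C`), then
  `|∫_{T₁}^{T₂} log‖F(x₀+it)‖ dt| ≤ 3C/log 2`, uniformly in `T₁ ≤ T₂`;
* `Literature.Analysis.Complex.abs_integral_log_norm_dirichletPolynomial_le` — the Dirichlet
  polynomial case `F(s) = Σ_{n≤N} a_n n^{-s}`, `a_1 = 1`, `Σ_{2≤n≤N} |a_n| n^{-x₀} ≤ C ≤ ½`: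
  Levinson's `∫_T^{T+U} log|ψ(3+it)| dt = O(1)`.

Everything here is proved; no definitions, no named facts.

## References

* N. Levinson, *More than one third of zeros of Riemann's zeta-function are on `σ = 1/2`*, Adv.
  Math. 13 (1974), 383–436, §2 (p. 387). [Levinson1974]
* E. C. Titchmarsh, *The Theory of the Riemann Zeta-Function*, 2nd ed. (rev. D. R. Heath-Brown),
  OUP 1986, §9.16, §10.28. [Titchmarsh1986]
-/

noncomputable section

open Complex Set MeasureTheory Filter intervalIntegral
open scoped Real Topology Interval

namespace Literature.Analysis.Complex

/-! ### The finite rectangle -/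

/-- **Cauchy–Goursat for `log F` on `[x₀, R] × [T₁, T₂]`.** Let `F` be analytic at every point of
the closed rectangle `K = [x₀, R] × [T₁, T₂]` with `‖F(σ+it) − 1‖ ≤ g(σ) ≤ ½` there, `g` integrable
on `[x₀, R]`. Then the principal `log F` is analytic on `K`, its boundary integral vanishes, and
bounding the other three edges by `‖log w‖ ≤ (3/2)‖w − 1‖` gives
`‖∫_{T₁}^{T₂} log F(x₀+it) dt‖ ≤ (3/2) · (2∫_{x₀}^R g(σ) dσ + (T₂ − T₁) g(R))`.
[cite: Levinson1974, §2 (p. 387)] -/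
theorem norm_integral_log_vertical_le {F : ℂ → ℂ} {x₀ R T₁ T₂ : ℝ} (hxR : x₀ ≤ R) (hT : T₁ ≤ T₂)
    {g : ℝ → ℝ} (hF : ∀ z ∈ Icc x₀ R ×ℂ Icc T₁ T₂, AnalyticAt ℂ F z)
    (hg : ∀ x ∈ Icc x₀ R, ∀ t ∈ Icc T₁ T₂, ‖F (x + t * I) - 1‖ ≤ g x)
    (hg2 : ∀ x ∈ Icc x₀ R, g x ≤ 1 / 2) (hgi : IntervalIntegrable g volume x₀ R) :
    ‖∫ t in T₁..T₂, log (F (x₀ + t * I))‖ ≤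
      3 / 2 * (2 * (∫ x in x₀..R, g x) + (T₂ - T₁) * g R) := by
  set G : ℂ → ℂ := fun z ↦ log (F z) with hG
  -- at points of `K`, `F` is within `1/2` of `1`, hence in the slit plane
  have hmem : ∀ {x t : ℝ}, x ∈ Icc x₀ R → t ∈ Icc T₁ T₂ →
      ((x : ℂ) + t * I) ∈ Icc x₀ R ×ℂ Icc T₁ T₂ := fun hx ht ↦ ⟨by simpa using hx, by simpa using ht⟩
  have hclose : ∀ z ∈ Icc x₀ R ×ℂ Icc T₁ T₂, ‖F z - 1‖ ≤ 1 / 2 := by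
    intro z hz
    have e : z = (z.re : ℂ) + (z.im : ℂ) * I := (re_add_im z).symm
    rw [e]
    exact (hg z.re hz.1 z.im hz.2).trans (hg2 z.re hz.1)
  have hslit : ∀ z ∈ Icc x₀ R ×ℂ Icc T₁ T₂, F z ∈ slitPlane := by
    intro z hz
    refine mem_slitPlane_iff.2 (Or.inl ?_)
    have h1 : |(F z - 1).re| ≤ 1 / 2 := (abs_re_le_norm _).trans (hclose z hz)
    rw [sub_re, one_re, abs_le] at h1
    linarith [h1.1]
  have hlog : ∀ z ∈ Icc x₀ R ×ℂ Icc T₁ T₂, ‖G z‖ ≤ 3 / 2 * ‖F z - 1‖ := by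
    intro z hz
    have := Complex.norm_log_one_add_half_le_self (z := F z - 1) (hclose z hz)
    simpa [hG] using this
  -- `log F` is complex differentiable on `K`: Cauchy–Goursat
  have hdiff : DifferentiableOn ℂ G (Icc x₀ R ×ℂ Icc T₁ T₂) := fun z hz ↦
    ((hF z hz).differentiableAt.clog (hslit z hz)).differentiableWithinAt
  have hCG := rectBoundaryIntegral_eq_zero_of_differentiableOn hxR hT hdiff
  rw [rectBoundaryIntegral] at hCG
  -- the three other edges
  have hbot : ‖∫ x in x₀..R, G (x + T₁ * I)‖ ≤ ∫ x in x₀..R, 3 / 2 * g x := by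
    refine intervalIntegral.norm_integral_le_of_norm_le hxR (Eventually.of_forall fun x hx ↦ ?_)
      (hgi.const_mul _)
    have hx' : x ∈ Icc x₀ R := Ioc_subset_Icc_self hx
    exact (hlog _ (hmem hx' ⟨le_rfl, hT⟩)).trans
      (mul_le_mul_of_nonneg_left (hg x hx' T₁ ⟨le_rfl, hT⟩) (by norm_num))
  have htop : ‖∫ x in x₀..R, G (x + T₂ * I)‖ ≤ ∫ x in x₀..R, 3 / 2 * g x := by
    refine intervalIntegral.norm_integral_le_of_norm_le hxR (Eventually.of_forall fun x hx ↦ ?_)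
      (hgi.const_mul _)
    have hx' : x ∈ Icc x₀ R := Ioc_subset_Icc_self hx
    exact (hlog _ (hmem hx' ⟨hT, le_rfl⟩)).trans
      (mul_le_mul_of_nonneg_left (hg x hx' T₂ ⟨hT, le_rfl⟩) (by norm_num))
  have hright : ‖∫ t in T₁..T₂, G (R + t * I)‖ ≤ 3 / 2 * g R * |T₂ - T₁| := by
    refine intervalIntegral.norm_integral_le_of_norm_le_const fun t ht ↦ ?_
    rw [uIoc_of_le hT] at ht
    have ht' : t ∈ Icc T₁ T₂ := Ioc_subset_Icc_self ht
    exact (hlog _ (hmem ⟨hxR, le_rfl⟩ ht')).trans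
      (mul_le_mul_of_nonneg_left (hg R ⟨hxR, le_rfl⟩ t ht') (by norm_num))
  -- the left edge from the other three
  set A : ℂ := ∫ x in x₀..R, G (x + T₁ * I) with hA
  set B : ℂ := ∫ x in x₀..R, G (x + T₂ * I) with hB
  set C : ℂ := ∫ t in T₁..T₂, G (R + t * I) with hC
  set L : ℂ := ∫ t in T₁..T₂, G (x₀ + t * I) with hL
  have hleft : I * L = A - B + I * C := by
    linear_combination (norm := ring_nf) -hCG
  have hnormL : ‖L‖ = ‖I * L‖ := by rw [norm_mul, norm_I, one_mul]
  have hnormC : ‖I * C‖ = ‖C‖ := by rw [norm_mul, norm_I, one_mul]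
  have h3 : ‖A - B + I * C‖ ≤ ‖A‖ + ‖B‖ + ‖C‖ := by
    calc ‖A - B + I * C‖ = ‖A + -B + I * C‖ := by rw [sub_eq_add_neg]
      _ ≤ ‖A‖ + ‖-B‖ + ‖I * C‖ := norm_add₃_le
      _ = ‖A‖ + ‖B‖ + ‖C‖ := by rw [norm_neg, hnormC]
  have hg32 : ∫ x in x₀..R, 3 / 2 * g x = 3 / 2 * ∫ x in x₀..R, g x :=
    intervalIntegral.integral_const_mul _ _
  rw [hg32] at hbot htop
  rw [hnormL, hleft]
  calc ‖A - B + I * C‖ ≤ ‖A‖ + ‖B‖ + ‖C‖ := h3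
    _ ≤ 3 / 2 * (∫ x in x₀..R, g x) + 3 / 2 * (∫ x in x₀..R, g x) + 3 / 2 * g R * |T₂ - T₁| :=
        add_le_add (add_le_add hbot htop) hright
    _ = 3 / 2 * (2 * (∫ x in x₀..R, g x) + (T₂ - T₁) * g R) := by
        rw [abs_of_nonneg (sub_nonneg.2 hT)]; ring

/-- **The mean of `log ‖F‖` on the left edge**, finite form: under the hypotheses of
`norm_integral_log_vertical_le`,
`|∫_{T₁}^{T₂} log‖F(x₀+it)‖ dt| ≤ (3/2) · (2∫_{x₀}^R g(σ) dσ + (T₂ − T₁) g(R))`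
(`log‖F‖ = Re log F`). [cite: Levinson1974, §2 (p. 387)] -/
theorem abs_integral_log_norm_vertical_le {F : ℂ → ℂ} {x₀ R T₁ T₂ : ℝ} (hxR : x₀ ≤ R)
    (hT : T₁ ≤ T₂) {g : ℝ → ℝ} (hF : ∀ z ∈ Icc x₀ R ×ℂ Icc T₁ T₂, AnalyticAt ℂ F z)
    (hg : ∀ x ∈ Icc x₀ R, ∀ t ∈ Icc T₁ T₂, ‖F (x + t * I) - 1‖ ≤ g x)
    (hg2 : ∀ x ∈ Icc x₀ R, g x ≤ 1 / 2) (hgi : IntervalIntegrable g volume x₀ R) :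
    |∫ t in T₁..T₂, Real.log ‖F (x₀ + t * I)‖| ≤
      3 / 2 * (2 * (∫ x in x₀..R, g x) + (T₂ - T₁) * g R) := by
  have hmem : ∀ {t : ℝ}, t ∈ Icc T₁ T₂ → ((x₀ : ℂ) + t * I) ∈ Icc x₀ R ×ℂ Icc T₁ T₂ :=
    fun ht ↦ ⟨by simpa using hxR, by simpa using ht⟩
  have hslit : ∀ t ∈ Icc T₁ T₂, F (x₀ + t * I) ∈ slitPlane := by
    intro t ht
    refine mem_slitPlane_iff.2 (Or.inl ?_)
    have h0 := (hg x₀ ⟨le_rfl, hxR⟩ t ht).trans (hg2 x₀ ⟨le_rfl, hxR⟩)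
    have h1 : |(F (x₀ + t * I) - 1).re| ≤ 1 / 2 := (abs_re_le_norm _).trans h0
    rw [sub_re, one_re, abs_le] at h1
    linarith [h1.1]
  -- `t ↦ log F(x₀ + it)` is continuous on `[T₁, T₂]`
  have hcont : ContinuousOn (fun t : ℝ ↦ log (F (x₀ + t * I))) (Icc T₁ T₂) := by
    intro t ht
    have h1 : ContinuousAt (fun t : ℝ ↦ (x₀ : ℂ) + t * I) t := by fun_prop
    have h2 : ContinuousAt F ((x₀ : ℂ) + t * I) := (hF _ (hmem ht)).continuousAt
    exact ((h2.comp (f := fun t : ℝ ↦ (x₀ : ℂ) + t * I) h1).clog (hslit t ht)).continuousWithinAt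
  have hint : IntervalIntegrable (fun t : ℝ ↦ log (F (x₀ + t * I))) volume T₁ T₂ :=
    (hcont.mono (by rw [uIcc_of_le hT])).intervalIntegrable
  have hre : ∫ t in T₁..T₂, Real.log ‖F (x₀ + t * I)‖ = (∫ t in T₁..T₂, log (F (x₀ + t * I))).re := by
    have := (reCLM.intervalIntegral_comp_comm hint)
    simp only [reCLM_apply, log_re] at this
    exact this
  rw [hre]
  exact (abs_re_le_norm _).trans (norm_integral_log_vertical_le hxR hT hF hg hg2 hgi)

/-! ### The half-strip: geometric decay -/

/-- `∫_{x₀}^R 2^{x₀−x} dx = (1 − 2^{x₀−R})/log 2 ≤ 1/log 2`. [folklore] -/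
lemma integral_two_rpow_sub_le (x₀ R : ℝ) :
    ∫ x in x₀..R, (2 : ℝ) ^ (x₀ - x) ≤ 1 / Real.log 2 := by
  have hlog2 : 0 < Real.log 2 := Real.log_pos one_lt_two
  have hderiv : ∀ x ∈ uIcc x₀ R,
      HasDerivAt (fun x : ℝ ↦ -(2 : ℝ) ^ (x₀ - x) / Real.log 2) ((2 : ℝ) ^ (x₀ - x)) x := by
    intro x _
    have h1 : HasDerivAt (fun x : ℝ ↦ x₀ - x) (-1) x := by
      simpa using (hasDerivAt_id x).const_sub x₀
    have h2 := h1.const_rpow (zero_lt_two' ℝ)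
    have h3 := (h2.neg).div_const (Real.log 2)
    have h4 : -(Real.log 2 * -1 * (2 : ℝ) ^ (x₀ - x)) / Real.log 2 = (2 : ℝ) ^ (x₀ - x) := by
      field_simp
    rw [h4] at h3
    exact h3
  have hcont : Continuous fun x : ℝ ↦ (2 : ℝ) ^ (x₀ - x) :=
    continuous_const.rpow (continuous_const.sub continuous_id) fun _ ↦ Or.inl two_ne_zero
  rw [intervalIntegral.integral_eq_sub_of_hasDerivAt hderiv (hcont.intervalIntegrable _ _)]
  have h0 : 0 ≤ (2 : ℝ) ^ (x₀ - R) := Real.rpow_nonneg zero_le_two _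
  rw [sub_self, Real.rpow_zero]
  have : -(2 : ℝ) ^ (x₀ - R) / Real.log 2 - -1 / Real.log 2 = (1 - (2 : ℝ) ^ (x₀ - R)) / Real.log 2 := by
    ring
  rw [this, div_le_div_iff_of_pos_right hlog2]
  linarith

/-- `2^{−y} ≤ 1/(y log 2)` for `y > 0` (`e^u ≥ 1 + u`). [folklore] -/
lemma two_rpow_neg_le_inv {y : ℝ} (hy : 0 < y) : (2 : ℝ) ^ (-y) ≤ 1 / (y * Real.log 2) := by
  have hlog2 : 0 < Real.log 2 := Real.log_pos one_lt_two
  have h1 : y * Real.log 2 ≤ (2 : ℝ) ^ y := by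
    rw [Real.rpow_def_of_pos zero_lt_two]
    have := Real.add_one_le_exp (Real.log 2 * y)
    nlinarith
  rw [Real.rpow_neg zero_le_two, ← one_div]
  exact one_div_le_one_div_of_le (by positivity) h1

/-- **The mean of `log ‖F‖` on the edge of a half-strip of geometric decay.** Let `F` be analytic
at every point of the closed half-strip `{σ ≥ x₀} × [T₁, T₂]` with
`‖F(σ+it) − 1‖ ≤ C · 2^{x₀−σ}` there, `C ≤ ½` — e.g. a Dirichlet series `1 + Σ_{n≥2} a_n n^{-s}`
with `Σ_{n≥2} |a_n| n^{-x₀} ≤ C`. Then, uniformly in `T₁ ≤ T₂`,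
`|∫_{T₁}^{T₂} log‖F(x₀+it)‖ dt| ≤ 3C/log 2`
(Levinson: "`≤ 8∫_3^∞ dσ/2^σ = O(1)`"; let `R → ∞` in `abs_integral_log_norm_vertical_le`).
[cite: Levinson1974, §2 (p. 387)] -/
theorem abs_integral_log_norm_vertical_le_of_geometric_decay {F : ℂ → ℂ} {x₀ T₁ T₂ C : ℝ}
    (hT : T₁ ≤ T₂) (hF : ∀ z : ℂ, x₀ ≤ z.re → z.im ∈ Icc T₁ T₂ → AnalyticAt ℂ F z) (hC : C ≤ 1 / 2)
    (hg : ∀ x : ℝ, x₀ ≤ x → ∀ t ∈ Icc T₁ T₂, ‖F (x + t * I) - 1‖ ≤ C * 2 ^ (x₀ - x)) :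
    |∫ t in T₁..T₂, Real.log ‖F (x₀ + t * I)‖| ≤ 3 * C / Real.log 2 := by
  have hlog2 : 0 < Real.log 2 := Real.log_pos one_lt_two
  have hC0 : 0 ≤ C := by
    have := (norm_nonneg _).trans (hg x₀ le_rfl T₁ ⟨le_rfl, hT⟩)
    simpa using this
  -- the finite bound for every `R ≥ x₀`
  have hfin : ∀ R : ℝ, x₀ ≤ R →
      |∫ t in T₁..T₂, Real.log ‖F (x₀ + t * I)‖| ≤
        3 * C / Real.log 2 + 3 / 2 * (T₂ - T₁) * C * 2 ^ (x₀ - R) := by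
    intro R hxR
    have h := abs_integral_log_norm_vertical_le (g := fun x ↦ C * (2 : ℝ) ^ (x₀ - x)) hxR hT
      (fun z hz ↦ hF z hz.1.1 hz.2) (fun x hx t ht ↦ hg x hx.1 t ht)
      (fun x hx ↦ by
        have h2 : (2 : ℝ) ^ (x₀ - x) ≤ 1 := Real.rpow_le_one_of_one_le_of_nonpos one_le_two
          (by linarith [hx.1])
        nlinarith)
      ((continuous_const.mul (continuous_const.rpow (continuous_const.sub continuous_id)
        fun _ ↦ Or.inl two_ne_zero)).intervalIntegrable _ _)
    have hI : ∫ x in x₀..R, C * (2 : ℝ) ^ (x₀ - x) ≤ C * (1 / Real.log 2) := by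
      rw [intervalIntegral.integral_const_mul]
      exact mul_le_mul_of_nonneg_left (integral_two_rpow_sub_le x₀ R) hC0
    calc |∫ t in T₁..T₂, Real.log ‖F (x₀ + t * I)‖|
        ≤ 3 / 2 * (2 * (∫ x in x₀..R, C * (2 : ℝ) ^ (x₀ - x)) + (T₂ - T₁) * (C * 2 ^ (x₀ - R))) := h
      _ ≤ 3 / 2 * (2 * (C * (1 / Real.log 2)) + (T₂ - T₁) * (C * 2 ^ (x₀ - R))) := by
          gcongr
      _ = 3 * C / Real.log 2 + 3 / 2 * (T₂ - T₁) * C * 2 ^ (x₀ - R) := by ring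
  -- let `R → ∞`
  refine le_of_forall_pos_le_add fun ε hε ↦ ?_
  set K : ℝ := 3 / 2 * (T₂ - T₁) * C / (ε * Real.log 2) + 1 with hK
  have hK0 : 0 < K := by
    have : 0 ≤ 3 / 2 * (T₂ - T₁) * C / (ε * Real.log 2) := by
      apply div_nonneg
      · nlinarith [sub_nonneg.2 hT]
      · positivity
    linarith
  have h1 := hfin (x₀ + K) (by linarith)
  have h2 : (2 : ℝ) ^ (x₀ - (x₀ + K)) ≤ 1 / (K * Real.log 2) := by
    rw [show x₀ - (x₀ + K) = -K by ring]
    exact two_rpow_neg_le_inv hK0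
  have h3 : 3 / 2 * (T₂ - T₁) * C * (2 : ℝ) ^ (x₀ - (x₀ + K)) ≤ ε := by
    have hM : 0 ≤ 3 / 2 * (T₂ - T₁) * C := by nlinarith [sub_nonneg.2 hT]
    calc 3 / 2 * (T₂ - T₁) * C * (2 : ℝ) ^ (x₀ - (x₀ + K))
        ≤ 3 / 2 * (T₂ - T₁) * C * (1 / (K * Real.log 2)) := mul_le_mul_of_nonneg_left h2 hM
      _ ≤ ε := by
          rw [mul_one_div, div_le_iff₀ (by positivity)]
          have hK' : 3 / 2 * (T₂ - T₁) * C / (ε * Real.log 2) ≤ K := by linarith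
          have := (div_le_iff₀ (by positivity : 0 < ε * Real.log 2)).1 hK'
          nlinarith
  linarith

/-! ### Dirichlet polynomials -/

/-- For `n ≥ 2` and `x₀ ≤ x`: `n^{−x} ≤ n^{−x₀} · 2^{x₀−x}`. [folklore] -/
lemma rpow_neg_le_rpow_neg_mul_two_rpow {n : ℕ} (hn : 2 ≤ n) {x₀ x : ℝ} (hx : x₀ ≤ x) :
    (n : ℝ) ^ (-x) ≤ (n : ℝ) ^ (-x₀) * (2 : ℝ) ^ (x₀ - x) := by
  have hn0 : (0 : ℝ) < n := by exact_mod_cast (zero_lt_two.trans_le hn)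
  have hn2 : (2 : ℝ) ≤ n := by exact_mod_cast hn
  rw [show -x = -x₀ + (x₀ - x) by ring, Real.rpow_add hn0]
  refine mul_le_mul_of_nonneg_left ?_ (Real.rpow_nonneg hn0.le _)
  exact Real.rpow_le_rpow_of_nonpos zero_lt_two hn2 (by linarith)

/-- **Levinson's `∫_T^{T+U} log|ψ(3+it)| dt = O(1)` for a Dirichlet polynomial.** Let
`F(s) = Σ_{n ≤ N} a_n n^{-s}` with `a_1 = 1` and `Σ_{2 ≤ n ≤ N} |a_n| n^{-x₀} ≤ C ≤ ½`. Then for all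
`T₁ ≤ T₂`, `|∫_{T₁}^{T₂} log‖F(x₀ + it)‖ dt| ≤ 3C/log 2` (in Levinson's method: `x₀ = 3`,
`ψ(s) = Σ_{n ≤ y} b_n n^{-s}`, `|b_n| ≤ 1`, `C = ζ(3) − 1`). [cite: Levinson1974, §2 (p. 387)] -/
theorem abs_integral_log_norm_dirichletPolynomial_le {a : ℕ → ℂ} {N : ℕ} {x₀ T₁ T₂ C : ℝ}
    (hT : T₁ ≤ T₂) (ha1 : a 1 = 1)
    (hC : ∑ n ∈ Finset.Icc 2 N, ‖a n‖ * (n : ℝ) ^ (-x₀) ≤ C) (hC2 : C ≤ 1 / 2) :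
    |∫ t in T₁..T₂, Real.log ‖∑ n ∈ Finset.Icc 1 N, a n * (n : ℂ) ^ (-((x₀ : ℂ) + t * I))‖| ≤
      3 * C / Real.log 2 := by
  set F : ℂ → ℂ := fun s ↦ ∑ n ∈ Finset.Icc 1 N, a n * (n : ℂ) ^ (-s) with hFdef
  -- `F` is entire
  have hFd : Differentiable ℂ F := by
    simp only [hFdef]
    refine Differentiable.fun_sum fun n hn ↦ ?_
    have hn0 : (n : ℂ) ≠ 0 := by
      have : 1 ≤ n := (Finset.mem_Icc.1 hn).1
      exact_mod_cast (Nat.one_le_iff_ne_zero.1 this)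
    refine (differentiable_const _).mul ?_
    intro s
    exact ((hasStrictDerivAt_const_cpow (Or.inl hn0)).hasDerivAt.differentiableAt).comp s
      differentiable_neg.differentiableAt
  have hFa : ∀ z : ℂ, x₀ ≤ z.re → z.im ∈ Icc T₁ T₂ → AnalyticAt ℂ F z := fun z _ _ ↦
    hFd.analyticAt z
  have hC0 : 0 ≤ C := le_trans (Finset.sum_nonneg fun n _ ↦ by positivity) hC
  have hlog2 : 0 < Real.log 2 := Real.log_pos one_lt_two
  by_cases hN : N = 0
  · -- empty polynomial: the integrand is `log ‖0‖ = 0`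
    subst hN
    have h0 : Finset.Icc 1 0 = (∅ : Finset ℕ) := Finset.Icc_eq_empty (by omega)
    simp only [h0, Finset.sum_empty, norm_zero, Real.log_zero, intervalIntegral.integral_zero,
      abs_zero]
    positivity
  have hN1 : 1 ≤ N := Nat.one_le_iff_ne_zero.2 hN
  -- the bound `‖F(x+it) − 1‖ ≤ C 2^{x₀−x}` for `x ≥ x₀`
  have hbound : ∀ x : ℝ, x₀ ≤ x → ∀ t ∈ Icc T₁ T₂, ‖F (x + t * I) - 1‖ ≤ C * 2 ^ (x₀ - x) := by
    intro x hx t _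
    have hsplit : F (x + t * I) - 1 = ∑ n ∈ Finset.Icc 2 N, a n * (n : ℂ) ^ (-((x : ℂ) + t * I)) := by
      simp only [hFdef]
      rw [← Finset.insert_Icc_add_one_left_eq_Icc hN1, Finset.sum_insert (by simp), ha1]
      simp
    rw [hsplit]
    calc ‖∑ n ∈ Finset.Icc 2 N, a n * (n : ℂ) ^ (-((x : ℂ) + t * I))‖
        ≤ ∑ n ∈ Finset.Icc 2 N, ‖a n * (n : ℂ) ^ (-((x : ℂ) + t * I))‖ := norm_sum_le _ _
      _ = ∑ n ∈ Finset.Icc 2 N, ‖a n‖ * (n : ℝ) ^ (-x) := by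
          refine Finset.sum_congr rfl fun n hn ↦ ?_
          have hn2 : 2 ≤ n := (Finset.mem_Icc.1 hn).1
          rw [norm_mul, Complex.norm_natCast_cpow_of_pos (by omega)]
          simp
      _ ≤ ∑ n ∈ Finset.Icc 2 N, ‖a n‖ * ((n : ℝ) ^ (-x₀) * (2 : ℝ) ^ (x₀ - x)) := by
          refine Finset.sum_le_sum fun n hn ↦ ?_
          have hn2 : 2 ≤ n := (Finset.mem_Icc.1 hn).1
          exact mul_le_mul_of_nonneg_left (rpow_neg_le_rpow_neg_mul_two_rpow hn2 hx)
            (norm_nonneg _)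
      _ = (∑ n ∈ Finset.Icc 2 N, ‖a n‖ * (n : ℝ) ^ (-x₀)) * (2 : ℝ) ^ (x₀ - x) := by
          rw [Finset.sum_mul]
          refine Finset.sum_congr rfl fun n _ ↦ ?_
          ring
      _ ≤ C * 2 ^ (x₀ - x) :=
          mul_le_mul_of_nonneg_right hC (Real.rpow_nonneg zero_le_two _)
  have h := abs_integral_log_norm_vertical_le_of_geometric_decay hT hFa hC2 hbound
  simp only [hFdef] at h
  exact h

end Literature.Analysis.Complex

end
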